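import Summits.ABC.StewartYu.PadicG3TwoArithBN
import Summits.ABC.StewartYu.PadicG3TwoBudgetZ
import HarnessLib

/-!
# Cell abc-stewartyu, WP-L.P(2) (crux r4 `PadicCoreTwoRat`, stmt-ABC-20504), record: the slots of the schedule of record `schedTwoN` in the
# BUDGET UNIT `Z = G·X·L`, I — weights and Hasse sizes with the `N`-depth

`Summits/ABC/StewartYu/PadicG3TwoBudgetZN.lean` — cell `abc-stewartyu`, route `YuMatveevShapeRat`, seat p3 (g10; memo-13 §1 + STATUS
20:34Z v3).  Theorems only; twin of p3-g6's `PadicG3TwoBudgetZ` on `schedTwoN` with the atoms of `PadicG3TwoArithN/ArithBN`: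
* `Bw3N_le_Bw3`, **`log_Bw3N_le_Z`** (`≤ (9/64)Z + G`, via `L03N ≤ L₀`);
* `L03N_real_le` (`L03N ≤ L₀/N + 1`), `div_add_log_le` (`(y + log N)/N ≤ y`);
* **`log_feldSizeN_le_Z`** — `log feldSizeN I r t ≤ (5/4)·Z + 2G + 25(d+2)` for `t ≤ T03N 0`, `3^{I*N−I}r ≤ 9·3^{I*N}·3^k·H` (`k ≤ d+3`): the depth
  `I*N·log 3 < log 3 + (d+25+m)log 2 + log N` is paid WITHOUT its `G` (`log N ≤ log L − G`), the `Y₀`-line by `L03N·(y + log N) ≤ L₀·y + …`.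

WHAT THIS IS NOT: the directional line / far heights (sequel `PadicG3TwoBudgetZBN`), the budget comparisons (`PadicG3TwoBudgetKN/TN`); no crux
moves.

References: Yu. V. Nesterenko, LNM 1819 (2003), §3.1 Prop 3.1, §4.2 (4.19)–(4.35); K. Yu, Acta Math. 211 (2013), §3.1, Lemma 5.2.
-/
noncomputable section

open Finset Real
open scoped Nat
open Literature.NumberTheory.Transcendental
open Literature.NumberTheory.Transcendental.CW77.Setup (Tau tauNorm)

namespace Summit.ABC.StewartYu

namespace TwoSetup

open Summit.ABC.StewartYu.G3Boxes Summit.ABC.StewartYu.PadicG3Par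

variable (S : TwoSetup) (F : S.SatData) (P : PadicG3Par (S.d + 1))

/-! ### The weights -/

/-- `Bw3N ≤ Bw3` (a supremum over the shorter range `ℓ ≤ L03N ≤ L₀`). [folklore] -/
theorem Bw3N_le_Bw3 : S.Bw3N F P ≤ S.Bw3 P := by
  unfold Bw3N
  refine Finset.sup'_le _ _ fun ℓ hℓ => S.Bw3_ge P ℓ ?_
  have := Finset.mem_range.mp hℓ
  have := S.L03N_le_L₀ F P
  omega

/-- **`log Bw3N ≤ (9/64)·Z + G`.** [cite: Nesterenko2003, §3.1 (3.5)–(3.6); shape only] -/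
theorem log_Bw3N_le_Z (hG : P.G = (P.m + 2) * Real.log 2) (hy : 2 * P.G ≤ P.yload) :
    Real.log (S.Bw3N F P) ≤ (9 / 64) * (P.G * P.X * P.L) + P.G :=
  (Real.log_le_log (S.Bw3N_pos F P) (S.Bw3N_le_Bw3 F P)).trans (S.log_Bw3_le_Z P hG hy)

/-! ### The `Y₀`-degree over `N` -/

/-- `L03N ≤ L₀/N + 1` (real). [folklore] -/
theorem L03N_real_le : (S.L03N F P : ℝ) ≤ (P.L₀ : ℝ) / F.N + 1 := by
  have hN : (0 : ℝ) < F.N := by exact_mod_cast F.hN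
  have h1 : (S.L03N F P : ℝ) < 6 * P.X * Cb ^ (S.d + 1) * P.Ω * P.K / F.N + 1 := by
    unfold L03N
    exact Nat.ceil_lt_add_one (by have := Cb_pos; have := P.Ω_pos; have := P.K_pos; positivity)
  have h2 : 6 * P.X * Cb ^ (S.d + 1) * P.Ω * P.K / (F.N : ℝ) ≤ (P.L₀ : ℝ) / F.N :=
    div_le_div_of_nonneg_right P.L₀_ge hN.le
  linarith

/-- `(y + log N)/N ≤ y` for `y ≥ 1`, `N ≥ 1` (`log N ≤ N − 1`). [folklore] -/
theorem div_add_log_le {y : ℝ} (hy : 1 ≤ y) {N : ℕ} (hN : 1 ≤ N) : (y + Real.log N) / N ≤ y := by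
  have hN1 : (1 : ℝ) ≤ N := by exact_mod_cast hN
  have hlog : Real.log N ≤ (N : ℝ) - 1 := Real.log_le_sub_one_of_pos (by linarith)
  rw [div_le_iff₀ (by linarith)]
  nlinarith

/-! ### The Hasse sizes -/

set_option maxHeartbeats 800000 in
/-- **`log feldSizeN I r t ≤ (5/4)·Z + 2G + 25(d+2)`** for `t ≤ T03N 0`, `3^{I*N−I}·r ≤ 9·3^{I*N}·3^k·H` (`k ≤ d+3`), at
`G = (m+2) log 2`, `2G ≤ yload`, `Nq = 2^{m+2}`, `N ≤ (2/log 2)^{d+1}Ω`. [cite: Nesterenko2003, §3.1 Prop 3.1, §4.2 (4.19)–(4.20); shape only] -/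
theorem log_feldSizeN_le_Z (hG : P.G = (P.m + 2) * Real.log 2) (hy : 2 * P.G ≤ P.yload) (hNq : P.Nq = 2 ^ (P.m + 2))
    (hN : (F.N : ℝ) ≤ (2 / Real.log 2) ^ (S.d + 1) * P.Ω)
    (I : ℕ) {r : ℝ} (hr : 0 ≤ r) {k : ℕ} (hk : k ≤ S.d + 3)
    (hre : (3 : ℝ) ^ (S.Istar3N F P - I) * r ≤ 9 * (3 : ℝ) ^ S.Istar3N F P * (3 : ℝ) ^ k * P.H)
    {t : ℕ} (ht : t ≤ S.T03N F P 0) :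
    Real.log (S.feldSizeN F P I r t) ≤ (5 / 4) * (P.G * P.X * P.L) + 2 * P.G + 25 * ((S.d : ℝ) + 1 + 1) := by
  obtain ⟨hX36, hG8, hL25, hLG, hLL, hLH, hXL⟩ := S.base_facts P
  obtain ⟨hL₀G, hL₀N⟩ := S.L₀_facts P hy
  set Z : ℝ := P.G * P.X * P.L with hZ
  set N1 : ℝ := (S.d : ℝ) + 1 + 1 with hN1
  have hd0 : (0 : ℝ) ≤ (S.d : ℝ) := by positivity
  have hN1' : 2 ≤ N1 := by rw [hN1]; linarith
  have hGpos : 0 < P.G := by linarith [P.eight_le_G]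
  have hHpos : (0 : ℝ) < P.H := by have : 1 ≤ P.H := le_max_left _ _; exact_mod_cast this
  have hL1 : (1 : ℝ) ≤ P.L := P.one_le_L
  have hNpos : (0 : ℝ) < F.N := by exact_mod_cast F.hN
  have hlog2 := log_two_le
  have hlog3 := log_three_le
  have hlog10 := log_ten_le
  have hlog3pos : 0 < Real.log 3 := Real.log_pos (by norm_num)
  rw [S.log_feldSizeN F P I hr t]
  -- (1) the start order: `t ≤ (8N1+12)L ≤ 14·N1·L`
  have hres := S.reserve_le_L F P hNq (S.N_le_L_nat F P hN)
  have hT := S.T03N_zero_le F P hres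
  have hL0 : (0 : ℝ) ≤ P.L := by positivity
  have htN : (t : ℝ) ≤ 14 * N1 * P.L := by
    have h1 : (t : ℝ) ≤ (8 * ((S.d : ℝ) + 1) + 20) * P.L := le_trans (by exact_mod_cast ht) hT
    have h2 : 8 * ((S.d : ℝ) + 1) + 20 ≤ 14 * N1 := by rw [hN1]; linarith
    have h3 := mul_le_mul_of_nonneg_right h2 hL0
    linarith
  -- (2) the depth without its `G`: `I*N·log 3 ≤ log 3 + (d+23)·log 2 + G + log N ≤ 1.2 + 0.7(d+23) + W_L`
  have hIs := S.Istar3N_mul_log_three_lt F P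
  have hlogN := S.log_N_le_sub_G F P hG hN
  have hlogL := P.log_L_le_WL
  have hWL := P.WL_mul_le
  have hWL1 := P.WL_ge_one
  have hIs' : (S.Istar3N F P : ℝ) * Real.log 3 ≤ 9 * N1 + P.WL := by
    have e : ((S.d : ℝ) + 1 + 24 + P.m) * Real.log 2 = ((S.d : ℝ) + 23) * Real.log 2 + (P.m + 2) * Real.log 2 := by ring
    rw [e, ← hG] at hIs
    have : ((S.d : ℝ) + 23) * Real.log 2 ≤ (7 / 10) * ((S.d : ℝ) + 23) := by nlinarith
    have hA : 6 / 5 + (7 / 10) * ((S.d : ℝ) + 23) ≤ 9 * N1 := by rw [hN1]; linarith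
    linarith
  -- (2a) `((I*N−I)·t)·log 3 ≤ t·(9N1 + W_L) ≤ 14N1·L·9N1 + (8N1+12)·L·W_L`
  have h2a : (((S.Istar3N F P - I) * t : ℕ) : ℝ) * Real.log 3 ≤ (7 / 16) * Z + (7 / 32) * Z := by
    have h1 : (((S.Istar3N F P - I) * t : ℕ) : ℝ) ≤ (S.Istar3N F P : ℝ) * t := by
      have : (S.Istar3N F P - I) * t ≤ S.Istar3N F P * t := Nat.mul_le_mul_right _ (Nat.sub_le _ _)
      exact_mod_cast this
    have h2 : (((S.Istar3N F P - I) * t : ℕ) : ℝ) * Real.log 3 ≤ (t : ℝ) * ((S.Istar3N F P : ℝ) * Real.log 3) := by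
      have := mul_le_mul_of_nonneg_right h1 hlog3pos.le
      have e : (S.Istar3N F P : ℝ) * t * Real.log 3 = (t : ℝ) * ((S.Istar3N F P : ℝ) * Real.log 3) := by ring
      linarith
    have ht0 : (0 : ℝ) ≤ t := by positivity
    have h3 : (t : ℝ) * ((S.Istar3N F P : ℝ) * Real.log 3) ≤ (t : ℝ) * (9 * N1) + (t : ℝ) * P.WL := by
      have := mul_le_mul_of_nonneg_left hIs' ht0; linarith
    -- `t·9N1 ≤ 126 N1² L ≤ (126/288) Z`
    have h4 : (t : ℝ) * (9 * N1) ≤ (7 / 16) * Z := by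
      have h6 : (t : ℝ) * (9 * N1) ≤ 14 * N1 * P.L * (9 * N1) := mul_le_mul_of_nonneg_right htN (by positivity)
      have e : 14 * N1 * P.L * (9 * N1) = (126 / 288) * (288 * N1 ^ 2 * P.L) := by ring
      rw [e] at h6
      linarith
    -- `t·W_L ≤ 14·N1·L·W_L ≤ (14/64) Z` (`(n+1)·L·W_L ≤ Z/64`, `n + 1 = N1`)
    have h5 : (t : ℝ) * P.WL ≤ (7 / 32) * Z := by
      have hWL' : N1 * P.L * P.WL ≤ Z / 64 := by
        have := hWL; push_cast at this; rw [hN1, hZ]; linarith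
      have h6 : (t : ℝ) * P.WL ≤ 14 * N1 * P.L * P.WL := mul_le_mul_of_nonneg_right htN (by linarith)
      have e : 14 * N1 * P.L * P.WL = 14 * (N1 * P.L * P.WL) := by ring
      rw [e] at h6
      linarith
    linarith
  -- (2b) `t·log ν(H) ≤ 14N1·L·(23/20)H ≤ (161/640) Z`
  have h2b : (t : ℝ) * Real.log (Nat.lcmUpto P.H) ≤ (161 / 640) * Z := by
    have hν := NWPi.log_lcmUpto_le P.H
    have hν0 : 0 ≤ Real.log (Nat.lcmUpto P.H) := Real.log_nonneg (by exact_mod_cast Nat.lcmUpto_pos P.H)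
    calc (t : ℝ) * Real.log (Nat.lcmUpto P.H) ≤ 14 * N1 * P.L * (23 / 20 * (P.H : ℝ)) :=
          mul_le_mul htN hν hν0 (by positivity)
      _ = (161 / 640) * (64 * N1 * (P.L * P.H)) := by ring
      _ ≤ (161 / 640) * Z := by linarith
  -- (2c) `H/e ≤ Z/2^30`
  have h2c : (P.H : ℝ) / Real.exp 1 ≤ Z / 2 ^ 30 := by
    have he : (1 : ℝ) ≤ Real.exp 1 := Real.one_le_exp zero_le_one
    have h1 : (P.H : ℝ) / Real.exp 1 ≤ P.H := div_le_self hHpos.le he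
    have h2 : (P.H : ℝ) * (64 * N1 * P.L) ≤ Z := by
      have e : (P.H : ℝ) * (64 * N1 * P.L) = 64 * N1 * (P.L * P.H) := by ring
      rw [e]; exact hLH
    have hNL : (2 : ℝ) * 2 ^ 25 ≤ N1 * P.L := mul_le_mul hN1' hL25 (by positivity) (by linarith)
    have h3 : (2 : ℝ) ^ 30 ≤ 64 * N1 * P.L := by
      have e : (64 : ℝ) * N1 * P.L = 64 * (N1 * P.L) := by ring
      rw [e]; norm_num at hNL ⊢; linarith
    have h4 : (P.H : ℝ) * 2 ^ 30 ≤ (P.H : ℝ) * (64 * N1 * P.L) := mul_le_mul_of_nonneg_left h3 hHpos.le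
    rw [le_div_iff₀ (by positivity)]
    linarith only [h1, h2, h4]
  -- (2d) the `Y₀`-line `L03N·(1 + log(1 + 3^{I*N−I} r/H)) ≤ L₀·y + y + log N`, `y = G + 12.5 N1`
  have h2d : (S.L03N F P : ℝ) * (1 + Real.log (1 + (3 : ℝ) ^ (S.Istar3N F P - I) * r / P.H)) ≤
      (1 / 8) * Z + (25 / 128) * Z + Z / 2 ^ 30 + 2 * P.G + 25 * N1 := by
    have hq : (3 : ℝ) ^ (S.Istar3N F P - I) * r / P.H ≤ 9 * (3 : ℝ) ^ S.Istar3N F P * (3 : ℝ) ^ k := by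
      rw [div_le_iff₀ hHpos]; linarith
    have hpos : 0 < 1 + (3 : ℝ) ^ (S.Istar3N F P - I) * r / P.H := by positivity
    have hlog : Real.log (1 + (3 : ℝ) ^ (S.Istar3N F P - I) * r / P.H) ≤
        Real.log 10 + (S.Istar3N F P : ℝ) * Real.log 3 + k * Real.log 3 := by
      have h1 : 1 + (3 : ℝ) ^ (S.Istar3N F P - I) * r / P.H ≤ 10 * ((3 : ℝ) ^ S.Istar3N F P * (3 : ℝ) ^ k) := by
        have hone : (1 : ℝ) ≤ (3 : ℝ) ^ S.Istar3N F P * (3 : ℝ) ^ k := one_le_mul_of_one_le_of_one_le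
          (one_le_pow₀ (by norm_num)) (one_le_pow₀ (by norm_num))
        linarith
      have h2 := Real.log_le_log hpos h1
      rw [Real.log_mul (by norm_num) (by positivity), Real.log_mul (by positivity) (by positivity),
        Real.log_pow, Real.log_pow] at h2
      linarith
    have hk' : (k : ℝ) * Real.log 3 ≤ (N1 + 1) * (6 / 5) := by
      have hk1 : (k : ℝ) ≤ N1 + 1 := by rw [hN1]; exact_mod_cast (by omega : k ≤ S.d + 1 + 1 + 1)
      exact mul_le_mul hk1 hlog3 hlog3pos.le (by positivity)
    -- the depth WITH `log N` kept: `I*N·log 3 ≤ 1.2 + 0.7(d+23) + G + log N`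
    have hIsN : (S.Istar3N F P : ℝ) * Real.log 3 ≤ 6 / 5 + (7 / 10) * ((S.d : ℝ) + 23) + P.G + Real.log F.N := by
      have e : ((S.d : ℝ) + 1 + 24 + P.m) * Real.log 2 = ((S.d : ℝ) + 23) * Real.log 2 + (P.m + 2) * Real.log 2 := by ring
      have hIs2 := S.Istar3N_mul_log_three_lt F P
      rw [e, ← hG] at hIs2
      have : ((S.d : ℝ) + 23) * Real.log 2 ≤ (7 / 10) * ((S.d : ℝ) + 23) := by nlinarith
      linarith
    set y : ℝ := P.G + (25 / 2) * N1 with hydef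
    have hy1 : 1 ≤ y := by rw [hydef]; linarith
    have hbr : 1 + Real.log (1 + (3 : ℝ) ^ (S.Istar3N F P - I) * r / P.H) ≤ y + Real.log F.N := by
      rw [hydef, hN1]; rw [hN1] at hk'; linarith
    have hL3 := S.L03N_real_le F P
    have hL30 : (0 : ℝ) ≤ S.L03N F P := by positivity
    have hlogN0 : 0 ≤ Real.log F.N := Real.log_nonneg (by exact_mod_cast F.hN)
    have hdiv := div_add_log_le hy1 F.hN
    have hL₀0 : (0 : ℝ) ≤ P.L₀ := by positivity
    -- `L03N·(y + log N) ≤ (L₀/N + 1)(y + log N) ≤ L₀·y + (y + log N)`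
    have hmain : (S.L03N F P : ℝ) * (1 + Real.log (1 + (3 : ℝ) ^ (S.Istar3N F P - I) * r / P.H)) ≤
        (P.L₀ : ℝ) * y + (y + Real.log F.N) := by
      calc (S.L03N F P : ℝ) * (1 + Real.log (1 + (3 : ℝ) ^ (S.Istar3N F P - I) * r / P.H))
          ≤ (S.L03N F P : ℝ) * (y + Real.log F.N) := mul_le_mul_of_nonneg_left hbr hL30
        _ ≤ ((P.L₀ : ℝ) / F.N + 1) * (y + Real.log F.N) := mul_le_mul_of_nonneg_right hL3 (by linarith)
        _ = (P.L₀ : ℝ) * ((y + Real.log F.N) / F.N) + (y + Real.log F.N) := by field_simp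
        _ ≤ (P.L₀ : ℝ) * y + (y + Real.log F.N) := by linarith [mul_le_mul_of_nonneg_left hdiv hL₀0]
    -- `L₀·y = L₀G + 12.5 N1 L₀ ≤ Z/8 + G + (25/128)(Z + 64 N1)`; `y + log N ≤ G + 12.5N1 + W_L ≤ … + Z/2^30`
    have hWLZ : P.WL ≤ Z / 2 ^ 30 := by
      have hWL' : N1 * P.L * P.WL ≤ Z / 64 := by
        have := hWL; push_cast at this; rw [hN1, hZ]; linarith
      have hNL : (2 : ℝ) * 2 ^ 25 ≤ N1 * P.L := mul_le_mul hN1' hL25 (by positivity) (by linarith)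
      have hprodWL := mul_le_mul_of_nonneg_right hNL (by linarith : (0 : ℝ) ≤ P.WL)
      rw [le_div_iff₀ (by positivity)]
      have e : N1 * P.L * P.WL = (N1 * P.L) * P.WL := by ring
      rw [e] at hWL'
      linarith only [hWL', hprodWL, hWL1]
    have hlogNZ : Real.log F.N ≤ Z / 2 ^ 30 := by linarith only [hlogN, hGpos.le, hlogL, hWLZ]
    have e1 : (P.L₀ : ℝ) * y = (P.L₀ : ℝ) * P.G + (25 / 128) * ((P.L₀ : ℝ) * (64 * N1)) := by rw [hydef]; ring
    have h3 : (25 / 128) * ((P.L₀ : ℝ) * (64 * N1)) ≤ (25 / 128) * (Z + 64 * N1) :=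
      mul_le_mul_of_nonneg_left hL₀N (by norm_num)
    rw [hydef] at hmain e1
    linarith only [hmain, e1, h3, hL₀G, hlogNZ]
  -- total: 7/16 + 7/32 + 161/640 + 2^{-30} + 1/8 + 25/128 + 2^{-30} ≤ 5/4
  have hZ0 : 0 ≤ Z := by rw [hZ]; have := P.GXL_ge; linarith [show (0:ℝ) ≤ 16*72*2^25 by positivity]
  linarith only [h2a, h2b, h2c, h2d, hZ0, hN1', hGpos]

end TwoSetup

end Summit.ABC.StewartYu

end
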